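import Literature.Analysis.FunctionSpaces.PointConfigKernel
import Literature.Analysis.FluidPDE.InfiniteHardSphereDynamics
import Literature.Analysis.FluidPDE.HardSphereFlowJointMeasurable
import Literature.Analysis.FluidPDE.HardSphereFreeStretch
import HarnessLib

/-!
# The Palm frame for local states of hard-sphere systems, II: rooted configurations and the
rooted space-time empirical local state of a finite orbit

Topic `Literature/Analysis/FluidPDE`; part (c) of the definition request `defn-PalmLocalState`
(route `PesinPricing` of `Summits/AtomisticToContinuum/HydrodynamicLimit`, crux `KiferYoungUpperR`:
"`R_N(z) := [(N+1)(t₂-t₁)]⁻¹ Σ_i ∫_{t₁}^{t₂} δ(localConfig G ε (Φ_s z i).1 (Φ_s z)) ds` — the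
configuration seen from particle `i` at time `s` (root at the origin, positions `× ε⁻¹` so unit
hard core, velocities kept), averaged over particles and times: a probability law on
`PointConfig (ℝ³ × ℝ³)`"), together with the ROOT VOCABULARY of configurations of `ℝᵈ × ℝᵈ` used by
the Palm file `PalmLocalState.lean` (which imports this one).

## Contents

* Window-sum API for `Literature.Analysis.FluidPDE.windowSum` (used here and by the Palm file):
  `tsum_particlesIn_eq`, `measurable_windowSum` (Campbell measurability), `particlesIn_singleton_eq`,
  `windowSum_singleton_eq` (on configurations with distinct positions the window `{x}` sees exactly
  the particle at `x`), `measurable_kineticIntegrand`.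
* ROOTED CONFIGURATIONS: `IsRooted ω` (`∃ v, (0, v) ∈ ω`; a measurable event,
  `measurableSet_isRooted`), `rootVelocity ω` (velocity of the particle at the origin, a classical
  choice, junk `0`), `rootKineticEnergy ω = ∑_{(0,v) ∈ ω} |v|²/2 ∈ [0, ∞]` (`windowSum` over the window
  `{0}`; `= |rootVelocity ω|²/2` on hard-core rooted configurations, `rootKineticEnergy_eq`).
* `rootedConfig Φ z (i, s) = localConfig G ε (Φ_s z i).1 (Φ_s z)`: the configuration of the orbit of
  `z` at time `s` seen from its particle `i` at the scale of the sphere diameter `ε` (Olla–Varadhan–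
  Yau 1993 §3 p. 535: "expand a neighborhood of `x` by `1/ε`"), and
  `rootedLocalState Φ z t₁ t₂ := (N (t₂ - t₁))⁻¹ Σ_i ∫_{t₁}^{t₂} δ_{rootedConfig Φ z (i,s)} ds` — the
  ROOTED SPACE-TIME EMPIRICAL LOCAL STATE of one finite orbit (push-forward of
  `count ⊗ Lebesgue|_{(t₁,t₂]}` on `Fin N × ℝ`, normalised): the particle-rooted version of OVY's
  `Q^ε` (4.1) for a single orbit, i.e. the space–time analogue of Georgii–Zessin's individual
  empirical field `R°_{n,ω} = |Λ_n|⁻¹ Σ_{x ∈ ω ∩ Λ_n} δ_{(u_x, ϑ_x ω)}` (1993, (2.6)).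
* Proved (general geometry `G`, under the side conditions that hold for `ℝᵈ` and `𝕋ᵈ`; all
  discharged in the `…_torus` corollaries): measurability of `rootedConfig Φ z` on good orbits
  (`HardSphereFlow.measurable_flow_prod`), the evaluation formula `rootedLocalState_apply`, total
  mass `1` / `IsProbabilityMeasure` for `t₁ < t₂`, `0 < N` (`isProbabilityMeasure_rootedLocalState`),
  the root is present SURELY (`isRooted_rootedConfig`, `ae_isRooted_rootedLocalState`), the Palm mark
  law of the orbit (`lintegral_windowSum_zero_rootedLocalState`:
  `E_R ∑_{(0,v)} f(0, v) = (N(t₂-t₁))⁻¹ Σ_i ∫ f(0, v_i(s)) ds`) and the energy identity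
  `E_R |v_root|²/2 = (N (t₂-t₁))⁻¹ Σ_i ∫_{t₁}^{t₂} |v_i(s)|²/2 ds = 𝖤(z)/N` by conservation of energy on
  good orbits (`lintegral_rootKineticEnergy_rootedLocalState`).

## Design choices

* The blow-up scale is the sphere diameter `ε` of the flow (unit hard core after blow-up, the
  normalisation of the route: `isHardCore_localConfig_euclidean` gives `IsHardCore 1` in `ℝᵈ`).
* `rootedLocalState` is a `Measure.map` (junk `0` if `rootedConfig Φ z` is not a.e.-measurable,
  which cannot happen for `z` in the good set of a flow on `ℝᵈ` or `𝕋ᵈ`, `measurable_rootedConfig`);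
  the normalisation `((N : ℝ≥0∞) · ofReal (t₂ - t₁))⁻¹` is junk (`∞`) for `t₂ ≤ t₁` or `N = 0`.
* General geometry `G : Geometry d X`; the lemmas carry the four side conditions — continuous
  translations, measurable separation map, `G.sepVec x x = 0`, injectivity of `y ↦ G.sepVec y x` —
  true for `Euclidean.geometry d` and `Torus.geometry d` (`…_torus` corollaries discharge them).
* Deliberately NOT here (remarks): (i) `rootedLocalState Φ z t₁ t₂` is the Palm law (file
  `PalmLocalState.lean`, `palmLaw`) of the space–time local law of the same orbit,
  `(t₂-t₁)⁻¹ ∫_{t₁}^{t₂} ds ∫ dx δ_{localConfig G ε x (Φ_s z)}` (OVY (4.1) without the expectation over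
  initial data, cf. `localLawTimeAvg`) — exactly in `ℝᵈ` (where that law is translation invariant,
  σ-finite, of intensity `N εᵈ` per unit cube, and recentring at the particles in a unit cube of the
  blown-up picture reproduces `(N εᵈ)⁻¹ · εᵈ Σ_i δ_{rootedConfig}`), and on `𝕋ᵈ` up to the
  minimal-image cut locus ("a little fuzzy at the edges"); the static printed analogue is
  Georgii–Zessin 1993 Remark 2.3 (3) ("`R°_{n,ω}` is the Palm measure of `R_{n,ω}`"). (ii) With
  `ε = hsDiameter σ N'`, `N = N' + 1` spheres on `𝕋³`, the intensity of that local law is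
  `N ε³ = σ³` exactly — the normalisation `intensity P = σ³` of the admissible class. Neither
  computation is formalised here.

## References

* S. Olla, S. R. S. Varadhan, H.-T. Yau, *Hydrodynamical limit for a Hamiltonian system with weak
  noise*, CMP 155 (1993), §3 (p. 535), §4 (4.1), Lemma 4.1.
* H.-O. Georgii, H. Zessin, PTRF 96 (1993), §2.2 (2.6), Remark 2.3.
* G. Last, M. Penrose, *Lectures on the Poisson Process* (2017), (9.7) (Palm laws live on rooted
  configurations), Prop. 2.7 (Campbell measurability).
-/

noncomputable section

open MeasureTheory Set Filter Function
open scoped ENNReal Topology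
open Literature.Analysis.FunctionSpaces

namespace Literature.Analysis.FluidPDE

/-! ## Window sums: measurability and evaluation on windows `{x}` -/

section WindowSum

variable {d : Type*}

local notation "𝔼" => EuclideanSpace ℝ d

/-- Sums over the particles in a window are sums over all particles of the window indicator.
[folklore] -/
theorem tsum_particlesIn_eq (ω : PointConfig (𝔼 × 𝔼)) (A : Set 𝔼) (G : 𝔼 × 𝔼 → ℝ≥0∞) :
    ∑' p : particlesIn ω A, G p =
      ∑' p : (ω : Set (𝔼 × 𝔼)), {p : 𝔼 × 𝔼 | p.1 ∈ A}.indicator G p := by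
  rw [tsum_subtype (ω : Set (𝔼 × 𝔼)) ({p : 𝔼 × 𝔼 | p.1 ∈ A}.indicator G), indicator_indicator,
    particlesIn_eq, tsum_subtype]
  rfl

/-- On a configuration with distinct positions the window `{x}` contains exactly the particle at
`x`. [folklore] -/
theorem particlesIn_singleton_eq {ω : PointConfig (𝔼 × 𝔼)} (hinj : InjOn Prod.fst (ω : Set (𝔼 × 𝔼)))
    {x v : 𝔼} (hv : (x, v) ∈ ω) : particlesIn ω {x} = {(x, v)} := by
  ext p
  simp only [mem_particlesIn_iff, mem_singleton_iff]
  constructor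
  · rintro ⟨hp, hpx⟩
    exact hinj hp hv hpx
  · rintro rfl
    exact ⟨hv, rfl⟩

/-- On a configuration with distinct positions a window functional over `{x}` evaluates the
integrand at the particle at `x`. [folklore] -/
theorem windowSum_singleton_eq {ω : PointConfig (𝔼 × 𝔼)} (hinj : InjOn Prod.fst (ω : Set (𝔼 × 𝔼)))
    {x v : 𝔼} (hv : (x, v) ∈ ω) (f : 𝔼 × 𝔼 → ℝ≥0∞) : windowSum ω {x} f = f (x, v) := by
  rw [windowSum, particlesIn_singleton_eq hinj hv, tsum_subtype,
    tsum_eq_single (x, v) fun b hb => indicator_of_notMem (fun h => hb (mem_singleton_iff.1 h)) f,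
    indicator_of_mem (mem_singleton _)]

variable [Fintype d]

/-- **Window sums are measurable** for a measurable window and a measurable nonnegative
integrand (Campbell measurability, `PointConfig.measurable_tsum_carrier`; Last–Penrose Prop. 2.7).
[cite: LastPenrose2017, Prop 2.7] -/
@[fun_prop]
theorem measurable_windowSum {A : Set 𝔼} (hA : MeasurableSet A) {G : 𝔼 × 𝔼 → ℝ≥0∞}
    (hG : Measurable G) :
    Measurable fun ω : PointConfig (𝔼 × 𝔼) => windowSum ω A G := by
  have h : (fun ω : PointConfig (𝔼 × 𝔼) => windowSum ω A G) = fun ω : PointConfig (𝔼 × 𝔼) =>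
      ∑' p : ((ω : PointConfig (𝔼 × 𝔼)) : Set (𝔼 × 𝔼)), {p : 𝔼 × 𝔼 | p.1 ∈ A}.indicator G p :=
    funext fun ω => tsum_particlesIn_eq ω A G
  rw [h]
  exact PointConfig.measurable_tsum_carrier
    (f := fun q : PointConfig (𝔼 × 𝔼) × (𝔼 × 𝔼) => {p : 𝔼 × 𝔼 | p.1 ∈ A}.indicator G q.2)
    ((hG.indicator (measurable_fst hA)).comp measurable_snd) measurable_id

/-- The kinetic-energy integrand `(x, v) ↦ |v|²/2` (mass `1`) is measurable. [folklore] -/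
@[fun_prop]
theorem measurable_kineticIntegrand :
    Measurable fun p : 𝔼 × 𝔼 => ENNReal.ofReal (‖p.2‖ ^ 2 / 2) :=
  ENNReal.measurable_ofReal.comp ((measurable_snd.norm.pow_const 2).div_const 2)

end WindowSum

/-! ## Rooted configurations: the particle at the origin -/

section Rooted

variable {d : Type*}

local notation "𝔼" => EuclideanSpace ℝ d

/-- `ω` is ROOTED: it has a particle at the origin (Palm laws are carried by such configurations:
Last–Penrose (9.7), "`P⁰` is concentrated on those `μ` having an atom at the origin";
Georgii–Zessin Remark 2.1: `P⁰` is supported on `{ω({(0, u)}) = 1}`). [cite: LastPenrose2017, (9.7)] -/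
def IsRooted (ω : PointConfig (𝔼 × 𝔼)) : Prop :=
  ∃ v : 𝔼, ((0 : 𝔼), v) ∈ ω

/-- Rootedness is a count event: some particle lies in `{0} × ℝᵈ`. [folklore] -/
theorem isRooted_iff_count_ne_zero (ω : PointConfig (𝔼 × 𝔼)) :
    IsRooted ω ↔ ω.count (({0} : Set 𝔼) ×ˢ (univ : Set 𝔼)) ≠ 0 := by
  rw [PointConfig.count, Set.encard_ne_zero]
  constructor
  · rintro ⟨v, hv⟩
    exact ⟨(0, v), hv, by simp [mem_prod]⟩
  · rintro ⟨p, hp, hp0⟩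
    refine ⟨p.2, ?_⟩
    have h1 : p.1 = 0 := by simpa [mem_prod] using hp0
    have : p = (0, p.2) := Prod.ext h1 rfl
    rw [← this]
    exact hp

variable [Fintype d]

/-- The rooted configurations form a measurable set. [folklore] -/
theorem measurableSet_isRooted : MeasurableSet {ω : PointConfig (𝔼 × 𝔼) | IsRooted ω} := by
  have h : {ω : PointConfig (𝔼 × 𝔼) | IsRooted ω} =
      (fun ω : PointConfig (𝔼 × 𝔼) => ω.count (({0} : Set 𝔼) ×ˢ (univ : Set 𝔼))) ⁻¹' {0}ᶜ := by
    ext ω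
    simp only [mem_setOf_eq, isRooted_iff_count_ne_zero, mem_preimage, mem_compl_iff,
      mem_singleton_iff]
  rw [h]
  exact PointConfig.measurable_count ((measurableSet_singleton 0).prod MeasurableSet.univ)
    MeasurableSpace.measurableSet_top

open Classical in
/-- The VELOCITY OF THE ROOT: the velocity `v` of the particle `(0, v)` at the origin (a classical
choice — unique on configurations with distinct positions, e.g. hard-core ones,
`rootVelocity_eq_of_mem`); junk value `0` on unrooted configurations. [folklore] -/
def rootVelocity (ω : PointConfig (𝔼 × 𝔼)) : 𝔼 :=
  if h : IsRooted ω then h.choose else 0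

omit [Fintype d] in
/-- The root's velocity is the velocity of a particle at the origin. [folklore] -/
theorem rootVelocity_mem {ω : PointConfig (𝔼 × 𝔼)} (h : IsRooted ω) :
    ((0 : 𝔼), rootVelocity ω) ∈ ω := by
  rw [rootVelocity, dif_pos h]
  exact h.choose_spec

omit [Fintype d] in
/-- Junk value: an unrooted configuration has root velocity `0`. [folklore] -/
theorem rootVelocity_of_not_isRooted {ω : PointConfig (𝔼 × 𝔼)} (h : ¬IsRooted ω) :
    rootVelocity ω = 0 := by
  rw [rootVelocity, dif_neg h]

omit [Fintype d] in
/-- On a configuration with distinct positions (e.g. a hard-core one, `IsHardCore.injOn_fst`) the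
root's velocity is THE velocity of the particle at the origin. [folklore] -/
theorem rootVelocity_eq_of_mem {ω : PointConfig (𝔼 × 𝔼)} (hinj : InjOn Prod.fst (ω : Set (𝔼 × 𝔼)))
    {v : 𝔼} (hv : ((0 : 𝔼), v) ∈ ω) : rootVelocity ω = v :=
  congrArg Prod.snd (hinj (rootVelocity_mem ⟨v, hv⟩) hv rfl)

/-- The KINETIC ENERGY OF THE ROOT, `∑_{(0, v) ∈ ω} |v|²/2 ∈ [0, ∞]`: the window functional
`windowSum` of `|v|²/2` over the window `{0}` (mass `1`; on configurations with distinct positions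
it is `|rootVelocity ω|²/2`, `rootKineticEnergy_eq`; `0` on unrooted ones). The functional whose Palm
expectation the route's admissible class caps (`E_Q |v_root|²/2 ≤ e₀`). [folklore] -/
def rootKineticEnergy (ω : PointConfig (𝔼 × 𝔼)) : ℝ≥0∞ :=
  windowSum ω {0} fun p => ENNReal.ofReal (‖p.2‖ ^ 2 / 2)

/-- Unfolding `rootKineticEnergy`. [folklore] -/
theorem rootKineticEnergy_eq_windowSum (ω : PointConfig (𝔼 × 𝔼)) :
    rootKineticEnergy ω = windowSum ω {0} fun p => ENNReal.ofReal (‖p.2‖ ^ 2 / 2) :=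
  rfl

/-- The root's kinetic energy is a measurable functional. [folklore] -/
@[fun_prop]
theorem measurable_rootKineticEnergy : Measurable (rootKineticEnergy (d := d)) :=
  measurable_windowSum (measurableSet_singleton 0) measurable_kineticIntegrand

/-- On a configuration with distinct positions, `rootKineticEnergy ω = |v|²/2` for the particle
`(0, v)` at the origin. [folklore] -/
theorem rootKineticEnergy_eq_of_mem {ω : PointConfig (𝔼 × 𝔼)}
    (hinj : InjOn Prod.fst (ω : Set (𝔼 × 𝔼))) {v : 𝔼} (hv : ((0 : 𝔼), v) ∈ ω) :
    rootKineticEnergy ω = ENNReal.ofReal (‖v‖ ^ 2 / 2) :=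
  windowSum_singleton_eq hinj hv _

/-- On a rooted hard-core configuration, `rootKineticEnergy ω = |rootVelocity ω|²/2`. [folklore] -/
theorem rootKineticEnergy_eq {ε : ℝ} {ω : PointConfig (𝔼 × 𝔼)} (hε : 0 < ε) (hω : IsHardCore ε ω)
    (h : IsRooted ω) : rootKineticEnergy ω = ENNReal.ofReal (‖rootVelocity ω‖ ^ 2 / 2) :=
  rootKineticEnergy_eq_of_mem (hω.injOn_fst hε) (rootVelocity_mem h)

/-- An unrooted configuration has root kinetic energy `0` (empty window). [folklore] -/
theorem rootKineticEnergy_of_not_isRooted {ω : PointConfig (𝔼 × 𝔼)} (h : ¬IsRooted ω) :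
    rootKineticEnergy ω = 0 := by
  have he : particlesIn ω ({0} : Set 𝔼) = ∅ := by
    ext p
    simp only [mem_particlesIn_iff, mem_singleton_iff, mem_empty_iff_false, iff_false, not_and]
    intro hp hp0
    refine h ⟨p.2, ?_⟩
    rw [← hp0]
    exact hp
  rw [rootKineticEnergy, windowSum, he]
  exact tsum_empty

end Rooted

/-! ## The rooted space-time empirical local state of a finite orbit -/

section Orbit

variable {d : Type*} [Fintype d] {X : Type*} [MeasureSpace X] [TopologicalSpace X] {N : ℕ}
  {G : Geometry d X} {ε : ℝ}

local notation "𝔼" => EuclideanSpace ℝ d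

/-- The configuration of the orbit of `z` at time `s` SEEN FROM ITS PARTICLE `i`, at the scale of
the sphere diameter: `rootedConfig Φ z (i, s) = localConfig G ε (Φ_s z i).1 (Φ_s z)` — root at the
origin, positions blown up by `ε⁻¹` (unit hard core), velocities kept (OVY 1993 §3 p. 535).
[cite: OllaVaradhanYau1993, §3 (p. 535)] -/
def rootedConfig (Φ : HardSphereFlow G ε N) (z : Config N d X) (p : Fin N × ℝ) :
    PointConfig (𝔼 × 𝔼) :=
  localConfig G ε (Φ.flow p.2 z p.1).1 (Φ.flow p.2 z)

/-- Unfolding `rootedConfig`. [folklore] -/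
theorem rootedConfig_apply (Φ : HardSphereFlow G ε N) (z : Config N d X) (i : Fin N) (s : ℝ) :
    rootedConfig Φ z (i, s) = localConfig G ε (Φ.flow s z i).1 (Φ.flow s z) :=
  rfl

/-- **The rooted space-time empirical local state** of the orbit of `z` over the window
`(t₁, t₂]`: `R(z) = (N (t₂ - t₁))⁻¹ Σ_i ∫_{t₁}^{t₂} δ_{rootedConfig Φ z (i, s)} ds`, the law of the
configuration seen from a uniformly chosen particle at a uniformly chosen time — the push-forward
of `count ⊗ Lebesgue|_{(t₁, t₂]}` on `Fin N × ℝ` under `rootedConfig Φ z`, normalised (the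
particle-rooted, single-orbit version of OVY's space-time average `Q^ε`, (4.1); the space-time
analogue of Georgii–Zessin's individual empirical field `R°_{n,ω}`, (2.6)). A probability law carried
by rooted configurations for `z` in the good set, `t₁ < t₂`, `0 < N`.
[cite: OllaVaradhanYau1993, §4 (4.1)] -/
def rootedLocalState (Φ : HardSphereFlow G ε N) (z : Config N d X) (t₁ t₂ : ℝ) :
    Measure (PointConfig (𝔼 × 𝔼)) :=
  ((N : ℝ≥0∞) * ENNReal.ofReal (t₂ - t₁))⁻¹ •
    ((Measure.count : Measure (Fin N)).prod ((volume : Measure ℝ).restrict (Ioc t₁ t₂))).map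
      (rootedConfig Φ z)

omit [MeasureSpace X] [TopologicalSpace X] in
/-- **The root is present, surely**: seen from its own particle `i`, a configuration has the
particle `(0, v_i)` at the origin (requires `G.sepVec x x = 0`, true on `ℝᵈ` and `𝕋ᵈ`). [folklore] -/
theorem mem_localConfig_self (hG0 : ∀ x : X, G.sepVec x x = 0) (ε : ℝ) (w : Config N d X) (i : Fin N) :
    ((0 : 𝔼), (w i).2) ∈ localConfig G ε (w i).1 w :=
  (mem_localConfig_iff G ε (w i).1 w _).2 ⟨i, by rw [hG0, smul_zero]⟩

/-- Every rooted configuration of an orbit is rooted. [folklore] -/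
theorem isRooted_rootedConfig (Φ : HardSphereFlow G ε N) (hG0 : ∀ x : X, G.sepVec x x = 0)
    (z : Config N d X) (p : Fin N × ℝ) : IsRooted (rootedConfig Φ z p) :=
  ⟨_, mem_localConfig_self hG0 ε (Φ.flow p.2 z) p.1⟩

omit [MeasureSpace X] [TopologicalSpace X] in
/-- In the hard-sphere domain with `ε > 0`, the particles of a local configuration have DISTINCT
POSITIONS, provided `G.sepVec x x = 0` and `y ↦ G.sepVec y x` is injective (both true on `ℝᵈ` and
`𝕋ᵈ`): two labels with the same blown-up position have the same position, which the hard core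
forbids. [folklore] -/
theorem injOn_fst_localConfig (hε : 0 < ε) (hG0 : ∀ x : X, G.sepVec x x = 0)
    (hGinj : ∀ x : X, Injective fun y => G.sepVec y x) {w : Config N d X}
    (hw : w ∈ hardSphereDomain G N ε) (x : X) :
    InjOn Prod.fst ((localConfig G ε x w : PointConfig (𝔼 × 𝔼)) : Set (𝔼 × 𝔼)) := by
  rintro _ ⟨j, rfl⟩ _ ⟨k, rfl⟩ hjk
  dsimp only at hjk
  have h1 : G.sepVec (w j).1 x = G.sepVec (w k).1 x :=
    smul_right_injective 𝔼 (inv_ne_zero hε.ne') hjk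
  have h2 : (w j).1 = (w k).1 := hGinj x h1
  have hjk' : j = k := by
    by_contra hne
    have h3 := hw j k hne
    rw [h2, hG0, norm_zero] at h3
    exact absurd h3 (not_le.2 hε)
  rw [hjk']

omit [MeasureSpace X] [TopologicalSpace X] in
/-- Seen from particle `i`, a window functional over `{0}` evaluates the integrand at `(0, v_i)`
(hard-sphere domain, `ε > 0`, geometry side conditions). [folklore] -/
theorem windowSum_zero_localConfig_self (hε : 0 < ε) (hG0 : ∀ x : X, G.sepVec x x = 0)
    (hGinj : ∀ x : X, Injective fun y => G.sepVec y x) {w : Config N d X}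
    (hw : w ∈ hardSphereDomain G N ε) (i : Fin N) (f : 𝔼 × 𝔼 → ℝ≥0∞) :
    windowSum (localConfig G ε (w i).1 w) {0} f = f (0, (w i).2) :=
  windowSum_singleton_eq (injOn_fst_localConfig hε hG0 hGinj hw _) (mem_localConfig_self hG0 ε w i) f

section Measurable

variable [TopologicalSpace.PseudoMetrizableSpace X] [SecondCountableTopology X] [BorelSpace X]

/-- A good orbit is measurable in time (right-continuity; `HardSphereFlow.measurable_flow_prod`).
[folklore] -/
theorem HardSphereFlow.measurable_orbit (Φ : HardSphereFlow G ε N)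
    (hG : ∀ x : X, Continuous (G.translate x)) {z : Config N d X} (hz : z ∈ Φ.good) :
    Measurable fun s : ℝ => Φ.flow s z :=
  (Φ.measurable_flow_prod hG).comp
    ((measurable_const (a := (⟨z, hz⟩ : Φ.good))).prodMk measurable_id)

/-- **`rootedConfig Φ z` is measurable on `Fin N × ℝ`** for `z` in the good set (so
`rootedLocalState` is a genuine push-forward): the orbit is measurable in time and `localConfig` is
jointly measurable (`measurable_localConfig`). [folklore] -/
theorem measurable_rootedConfig (Φ : HardSphereFlow G ε N) (hG : ∀ x : X, Continuous (G.translate x))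
    (hGm : Measurable fun p : X × X => G.sepVec p.1 p.2) {z : Config N d X} (hz : z ∈ Φ.good) :
    Measurable (rootedConfig Φ z) := by
  have horb := Φ.measurable_orbit hG hz
  have hcfg : Measurable fun p : Fin N × ℝ => Φ.flow p.2 z := horb.comp measurable_snd
  have hpos : Measurable fun p : Fin N × ℝ => (Φ.flow p.2 z p.1).1 := by
    refine measurable_from_prod_countable_right fun i => ?_
    exact ((measurable_pi_apply i).comp horb).fst
  exact (measurable_localConfig G hGm ε).comp (hpos.prodMk hcfg)

/-- **Evaluation of the rooted local state** on a measurable set of configurations: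
`R(z)(A) = (N (t₂ - t₁))⁻¹ Σ_i Leb{s ∈ (t₁, t₂] : rootedConfig Φ z (i, s) ∈ A}`. [folklore] -/
theorem rootedLocalState_apply (Φ : HardSphereFlow G ε N) (hG : ∀ x : X, Continuous (G.translate x))
    (hGm : Measurable fun p : X × X => G.sepVec p.1 p.2) {z : Config N d X} (hz : z ∈ Φ.good)
    (t₁ t₂ : ℝ) {A : Set (PointConfig (𝔼 × 𝔼))} (hA : MeasurableSet A) :
    rootedLocalState Φ z t₁ t₂ A = ((N : ℝ≥0∞) * ENNReal.ofReal (t₂ - t₁))⁻¹ *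
      ∑ i : Fin N, volume {s : ℝ | s ∈ Ioc t₁ t₂ ∧ rootedConfig Φ z (i, s) ∈ A} := by
  have hm := measurable_rootedConfig Φ hG hGm hz
  rw [rootedLocalState, Measure.smul_apply, smul_eq_mul, Measure.map_apply hm hA,
    Measure.prod_apply (hm hA), lintegral_count, tsum_fintype]
  congr 1
  refine Finset.sum_congr rfl fun i _ => ?_
  rw [Measure.restrict_apply' measurableSet_Ioc]
  congr 1
  ext s
  simp only [mem_inter_iff, mem_preimage, mem_setOf_eq]
  tauto

/-- **Total mass**: for `t₁ < t₂` and `0 < N` the rooted local state of a good orbit has mass `1`.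
[folklore] -/
theorem rootedLocalState_univ (Φ : HardSphereFlow G ε N) (hG : ∀ x : X, Continuous (G.translate x))
    (hGm : Measurable fun p : X × X => G.sepVec p.1 p.2) {z : Config N d X} (hz : z ∈ Φ.good)
    {t₁ t₂ : ℝ} (ht : t₁ < t₂) (hN : N ≠ 0) : rootedLocalState Φ z t₁ t₂ univ = 1 := by
  have hm := measurable_rootedConfig Φ hG hGm hz
  rw [rootedLocalState, Measure.smul_apply, smul_eq_mul, Measure.map_apply hm MeasurableSet.univ,
    preimage_univ, ← univ_prod_univ, Measure.prod_prod, ← Finset.coe_univ, Measure.count_apply_finset,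
    Finset.card_univ, Fintype.card_fin, Measure.restrict_apply MeasurableSet.univ, univ_inter,
    Real.volume_Ioc]
  refine ENNReal.inv_mul_cancel ?_ ?_
  · exact mul_ne_zero (by exact_mod_cast hN) (by rw [Ne, ENNReal.ofReal_eq_zero, not_le]; linarith)
  · exact ENNReal.mul_ne_top (ENNReal.natCast_ne_top N) ENNReal.ofReal_ne_top

/-- The rooted local state of a good orbit is a probability law (`t₁ < t₂`, `0 < N`). [folklore] -/
theorem isProbabilityMeasure_rootedLocalState (Φ : HardSphereFlow G ε N)
    (hG : ∀ x : X, Continuous (G.translate x)) (hGm : Measurable fun p : X × X => G.sepVec p.1 p.2)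
    {z : Config N d X} (hz : z ∈ Φ.good) {t₁ t₂ : ℝ} (ht : t₁ < t₂) (hN : N ≠ 0) :
    IsProbabilityMeasure (rootedLocalState Φ z t₁ t₂) :=
  ⟨rootedLocalState_univ Φ hG hGm hz ht hN⟩

/-- **The rooted local state is carried by rooted configurations** (surely on the image, hence
almost surely). [folklore] -/
theorem ae_isRooted_rootedLocalState (Φ : HardSphereFlow G ε N)
    (hG : ∀ x : X, Continuous (G.translate x)) (hGm : Measurable fun p : X × X => G.sepVec p.1 p.2)
    (hG0 : ∀ x : X, G.sepVec x x = 0) {z : Config N d X} (hz : z ∈ Φ.good) (t₁ t₂ : ℝ) :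
    ∀ᵐ ω ∂(rootedLocalState Φ z t₁ t₂), IsRooted ω := by
  rw [ae_iff, show {ω : PointConfig (𝔼 × 𝔼) | ¬IsRooted ω} = {ω | IsRooted ω}ᶜ from rfl,
    rootedLocalState_apply Φ hG hGm hz t₁ t₂ measurableSet_isRooted.compl]
  refine mul_eq_zero_of_right _ (Finset.sum_eq_zero fun i _ => ?_)
  have h : {s : ℝ | s ∈ Ioc t₁ t₂ ∧ rootedConfig Φ z (i, s) ∈ {ω : PointConfig (𝔼 × 𝔼) | IsRooted ω}ᶜ} = ∅ :=
    eq_empty_iff_forall_notMem.2 fun s hs => hs.2 (isRooted_rootedConfig Φ hG0 z (i, s))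
  rw [h, measure_empty]

/-- **Palm mark law of one orbit**: the expectation under the rooted local state of a window
functional over `{0}` is the space–time average over the particles,
`E_R ∑_{(0,v) ∈ ω} f(0, v) = (N (t₂ - t₁))⁻¹ Σ_i ∫_{t₁}^{t₂} f(0, v_i(s)) ds` (good orbit, `ε > 0`,
geometry side conditions). [folklore] -/
theorem lintegral_windowSum_zero_rootedLocalState (Φ : HardSphereFlow G ε N)
    (hG : ∀ x : X, Continuous (G.translate x)) (hGm : Measurable fun p : X × X => G.sepVec p.1 p.2)
    (hG0 : ∀ x : X, G.sepVec x x = 0) (hGinj : ∀ x : X, Injective fun y => G.sepVec y x) (hε : 0 < ε)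
    {z : Config N d X} (hz : z ∈ Φ.good) (t₁ t₂ : ℝ) {f : 𝔼 × 𝔼 → ℝ≥0∞} (hf : Measurable f) :
    ∫⁻ ω, windowSum ω {0} f ∂(rootedLocalState Φ z t₁ t₂) =
      ((N : ℝ≥0∞) * ENNReal.ofReal (t₂ - t₁))⁻¹ *
        ∑ i : Fin N, ∫⁻ s in Ioc t₁ t₂, f (0, (Φ.flow s z i).2) := by
  have hm := measurable_rootedConfig Φ hG hGm hz
  rw [rootedLocalState, lintegral_smul_measure, smul_eq_mul,
    lintegral_map (measurable_windowSum (measurableSet_singleton 0) hf) hm,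
    lintegral_prod (fun p : Fin N × ℝ => windowSum (rootedConfig Φ z p) {0} f)
      ((measurable_windowSum (measurableSet_singleton 0) hf).comp hm).aemeasurable,
    lintegral_count, tsum_fintype]
  congr 1
  refine Finset.sum_congr rfl fun i _ => lintegral_congr fun s => ?_
  exact windowSum_zero_localConfig_self hε hG0 hGinj (Φ.good_subset (Φ.mapsTo_good s hz)) i f

/-- **The root's kinetic energy under the rooted local state is the energy per particle**:
`E_R |v_root|²/2 = (N (t₂ - t₁))⁻¹ Σ_i ∫_{t₁}^{t₂} |v_i(s)|²/2 ds = 𝖤(z) / N`, by conservation of the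
kinetic energy `𝖤 = configEnergy` along good orbits (`IsHardSphereTrajectory.configEnergy_eq_holds`)
— so the route's conserved cut `𝖤(z) ≤ e₀ N` is exactly `E_R |v_root|²/2 ≤ e₀`. [folklore] -/
theorem lintegral_rootKineticEnergy_rootedLocalState (Φ : HardSphereFlow G ε N)
    (hG : ∀ x : X, Continuous (G.translate x)) (hGm : Measurable fun p : X × X => G.sepVec p.1 p.2)
    (hG0 : ∀ x : X, G.sepVec x x = 0) (hGinj : ∀ x : X, Injective fun y => G.sepVec y x) (hε : 0 < ε)
    {z : Config N d X} (hz : z ∈ Φ.good) {t₁ t₂ : ℝ} (ht : t₁ < t₂) :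
    ∫⁻ ω, rootKineticEnergy ω ∂(rootedLocalState Φ z t₁ t₂) =
      (N : ℝ≥0∞)⁻¹ * ENNReal.ofReal (configEnergy z) := by
  have horb := Φ.measurable_orbit hG hz
  have hvi : ∀ i : Fin N, Measurable fun s : ℝ => ENNReal.ofReal (‖(Φ.flow s z i).2‖ ^ 2 / 2) := by
    intro i
    have h1 : Measurable fun s : ℝ => (Φ.flow s z i).2 := ((measurable_pi_apply i).comp horb).snd
    exact ENNReal.measurable_ofReal.comp ((h1.norm.pow_const 2).div_const 2)
  -- conservation of the kinetic energy along the good orbit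
  have hE : ∀ s : ℝ, ∑ i : Fin N, ENNReal.ofReal (‖(Φ.flow s z i).2‖ ^ 2 / 2) =
      ENNReal.ofReal (configEnergy z) := by
    intro s
    have hcons : configEnergy (Φ.flow s z) = configEnergy z := by
      have h := IsHardSphereTrajectory.configEnergy_eq_holds (Φ.isTrajectory z hz) s 0
      rw [Φ.flow_zero z hz] at h
      exact h
    rw [← ENNReal.ofReal_sum_of_nonneg fun i _ => by positivity, ← hcons, configEnergy,
      Finset.mul_sum]
    refine congrArg ENNReal.ofReal (Finset.sum_congr rfl fun i _ => ?_)
    ring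
  have hswap : ∑ i : Fin N, ∫⁻ s in Ioc t₁ t₂, ENNReal.ofReal (‖(Φ.flow s z i).2‖ ^ 2 / 2) =
      ∫⁻ s in Ioc t₁ t₂, ENNReal.ofReal (configEnergy z) := by
    rw [← lintegral_finsetSum _ fun i _ => hvi i]
    exact lintegral_congr fun s => hE s
  have hT0 : ENNReal.ofReal (t₂ - t₁) ≠ 0 := by
    rw [Ne, ENNReal.ofReal_eq_zero, not_le]
    linarith
  have hTtop : ENNReal.ofReal (t₂ - t₁) ≠ ∞ := ENNReal.ofReal_ne_top
  show ∫⁻ ω, windowSum ω {0} (fun p => ENNReal.ofReal (‖p.2‖ ^ 2 / 2)) ∂(rootedLocalState Φ z t₁ t₂) = _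
  rw [lintegral_windowSum_zero_rootedLocalState Φ hG hGm hG0 hGinj hε hz t₁ t₂
    measurable_kineticIntegrand, hswap, setLIntegral_const, Real.volume_Ioc,
    ENNReal.mul_inv (Or.inr hTtop) (Or.inl (ENNReal.natCast_ne_top N)), mul_assoc,
    mul_comm (ENNReal.ofReal (configEnergy z)), ← mul_assoc (ENNReal.ofReal (t₂ - t₁))⁻¹,
    ENNReal.inv_mul_cancel hT0 hTtop, one_mul]

end Measurable

end Orbit

/-! ## The flat torus: all side conditions hold -/

section TorusOrbit

variable {d : Type*} [Fintype d] {N : ℕ} {ε : ℝ}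

/-- On `𝕋ᵈ` the minimal-image separation of a point from itself vanishes. [folklore] -/
theorem Torus.geometry_sepVec_self (x : UnitAddTorus d) : (Torus.geometry d).sepVec x x = 0 := by
  rw [Torus.geometry_sepVec, sub_self, Torus.reprSym_zero]

/-- On `𝕋ᵈ` the minimal-image separation `y ↦ reprSym (y - x)` is injective (`reprSym` is a
section of the covering map). [folklore] -/
theorem Torus.geometry_sepVec_left_injective (x : UnitAddTorus d) :
    Injective fun y => (Torus.geometry d).sepVec y x := by
  intro y y' h
  have h' := congrArg FunctionSpaces.Torus.proj h
  simp only [Torus.geometry_sepVec, Torus.proj_reprSym] at h'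
  exact sub_left_injective h'

/-- On `𝕋ᵈ`, `rootedConfig Φ z` is measurable for every good `z`. [folklore] -/
theorem measurable_rootedConfig_torus (Φ : HardSphereFlow (Torus.geometry d) ε N)
    {z : Config N d (UnitAddTorus d)} (hz : z ∈ Φ.good) : Measurable (rootedConfig Φ z) :=
  measurable_rootedConfig Φ Torus.continuous_geometry_translate Torus.measurable_geometry_sepVec hz

/-- On `𝕋ᵈ`, the rooted local state of a good orbit is a probability law (`t₁ < t₂`, `0 < N`).
[folklore] -/
theorem isProbabilityMeasure_rootedLocalState_torus (Φ : HardSphereFlow (Torus.geometry d) ε N)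
    {z : Config N d (UnitAddTorus d)} (hz : z ∈ Φ.good) {t₁ t₂ : ℝ} (ht : t₁ < t₂) (hN : N ≠ 0) :
    IsProbabilityMeasure (rootedLocalState Φ z t₁ t₂) :=
  isProbabilityMeasure_rootedLocalState Φ Torus.continuous_geometry_translate
    Torus.measurable_geometry_sepVec hz ht hN

/-- On `𝕋ᵈ`, the rooted local state of a good orbit is carried by rooted configurations.
[folklore] -/
theorem ae_isRooted_rootedLocalState_torus (Φ : HardSphereFlow (Torus.geometry d) ε N)
    {z : Config N d (UnitAddTorus d)} (hz : z ∈ Φ.good) (t₁ t₂ : ℝ) :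
    ∀ᵐ ω ∂(rootedLocalState Φ z t₁ t₂), IsRooted ω :=
  ae_isRooted_rootedLocalState Φ Torus.continuous_geometry_translate Torus.measurable_geometry_sepVec
    Torus.geometry_sepVec_self hz t₁ t₂

/-- On `𝕋ᵈ`, the Palm mark law of one orbit: `E_R ∑_{(0,v) ∈ ω} f(0, v) =
(N (t₂ - t₁))⁻¹ Σ_i ∫_{t₁}^{t₂} f(0, v_i(s)) ds` (good orbit, `ε > 0`). [folklore] -/
theorem lintegral_windowSum_zero_rootedLocalState_torus (Φ : HardSphereFlow (Torus.geometry d) ε N)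
    (hε : 0 < ε) {z : Config N d (UnitAddTorus d)} (hz : z ∈ Φ.good) (t₁ t₂ : ℝ)
    {f : EuclideanSpace ℝ d × EuclideanSpace ℝ d → ℝ≥0∞} (hf : Measurable f) :
    ∫⁻ ω, windowSum ω {0} f ∂(rootedLocalState Φ z t₁ t₂) =
      ((N : ℝ≥0∞) * ENNReal.ofReal (t₂ - t₁))⁻¹ *
        ∑ i : Fin N, ∫⁻ s in Ioc t₁ t₂, f (0, (Φ.flow s z i).2) :=
  lintegral_windowSum_zero_rootedLocalState Φ Torus.continuous_geometry_translate
    Torus.measurable_geometry_sepVec Torus.geometry_sepVec_self Torus.geometry_sepVec_left_injective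
    hε hz t₁ t₂ hf

/-- On `𝕋ᵈ`, **the root's kinetic energy under the rooted local state is the energy per
particle**, `E_R |v_root|²/2 = 𝖤(z)/N` (good orbit, `ε > 0`, `t₁ < t₂`). [folklore] -/
theorem lintegral_rootKineticEnergy_rootedLocalState_torus (Φ : HardSphereFlow (Torus.geometry d) ε N)
    (hε : 0 < ε) {z : Config N d (UnitAddTorus d)} (hz : z ∈ Φ.good) {t₁ t₂ : ℝ} (ht : t₁ < t₂) :
    ∫⁻ ω, rootKineticEnergy ω ∂(rootedLocalState Φ z t₁ t₂) =
      (N : ℝ≥0∞)⁻¹ * ENNReal.ofReal (configEnergy z) :=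
  lintegral_rootKineticEnergy_rootedLocalState Φ Torus.continuous_geometry_translate
    Torus.measurable_geometry_sepVec Torus.geometry_sepVec_self Torus.geometry_sepVec_left_injective
    hε hz ht

end TorusOrbit

end Literature.Analysis.FluidPDE
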